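import Mathlib.Data.Complex.Basic
import Mathlib.Data.List.GetD
import Mathlib.Tactic.IntervalCases
import Literature.Computability.AlgebraicComplexity.HomogenisationFormalDegree

/-!
# Route NumTame — crux `TameNF` (stmt-ValiantsHypothesis-5385), line `birth`, stub `stub_degreeNF`

Registered line `Cruxes/TameNF/Lines/birth.lean` (planner-skel 2026-08-17) cuts the crux
`Summit.ValiantsHypothesis.ValiantsHypothesis.Theses.NumTame.TameNF` (cube-tame normal form) into
`stub_degreeNF` (degree normal form), `stub_smallConstants` (the open core) and `stub_growth`
(growth lemma; landed in `NumTameTameNFStubGrowth.lean`), composed by the sorry-free `TameNF_of`.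
This file proves `stub_degreeNF` VERBATIM:

> DEGREE NORMAL FORM (uniform budget): if a fan-in-two `ℂ`-circuit `P` of size `≤ N` computes
> `f` with `deg f ≤ N`, then some fan-in-two circuit of size `≤ N^c + c` computes the same `f`
> with ALL gate formal degrees `≤ N^c + c` (here `c = 4`; constants stay arbitrary).

Proof. (1) The tree's homogenisation with formal degree
(`Literature/…/HomogenisationFormalDegree.lean`, BCS 1997 Lemma (21.25) with the degree-`0`
parts folded into sum weights): `ArithCircuit.exists_eq_formalDegree_le` rebuilds `P` into a
fan-in-two `Q` with the same value, `|Q| ≤ N²·|P| + N ≤ N³ + N` and OUTPUT formal degree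
`Q.formalDegree ≤ max N 1`. (2) A general capping lemma proved here
(`exists_forall_gateFormalDegrees_le`): in the tree's model the formal degree of a gate bounds
the formal degrees of its operands, so every gate that (transitively) feeds a node of formal
degree `≤ D` has formal degree `≤ D`; replacing every gate of formal degree `> D` by the empty
sum `Σ ∅` (value `0`, formal degree `0`) therefore changes neither the value nor the formal degree
of any node of formal degree `≤ D` — in particular not the output when `D ≥ Q.formalDegree` — and
leaves a circuit of the same size ALL of whose gate formal degrees are `≤ D`. (3) Bookkeeping:
`N³ + N ≤ N⁴ + 4` and `max N 1 ≤ N⁴ + 4`.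

Honest framing: a classical WLOG step (Strassen 1973; Malod–Portier 2008, Lemma 2; Bürgisser
2000, §2) on a registered line of an OPEN route; the crux `TameNF`, its open core
`stub_smallConstants` and the route remain open; nothing here bears on `VP ≠ VNP`.

## References

* [BurgisserClausenShokrollahi1997] P. Bürgisser, M. Clausen, M. A. Shokrollahi, *Algebraic
  Complexity Theory*, Springer 1997, §21.2 Lemma (21.25) (printed p. 550).
* [Burgisser2006] P. Bürgisser, *On defining integers and proving arithmetic circuit lower
  bounds*, Comput. Complexity 18 (2009), §2.2 (formal degree).
* [MalodPortier2008] G. Malod, N. Portier, *Characterizing Valiant's algebraic complexity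
  classes*, J. Complexity 24 (2008), Lemma 2 (homogeneous components / degree normal form).
-/

-- Sub = Summit layout duplicates the namespace component
set_option linter.dupNamespace false

noncomputable section

namespace Summit.ValiantsHypothesis.ValiantsHypothesis.Theorems.NumTame.TameNF

open Literature.Computability.AlgebraicComplexity ArithCircuit MvPolynomial

universe u v

variable {k : Type u} [CommSemiring k] {σ : Type v}

/-! ### Capping the formal degrees of unused gates -/

omit [CommSemiring k] in
/-- In the tree's model an operand of a gate has formal degree at most that of the gate (a sum
gate takes the maximum, a product gate the sum, of the formal degrees of its operands).
[cite: Burgisser2006, §2.2] -/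
theorem operand_formalDegree_le_gate (degs : List ℕ) (g : Gate k σ) {u : Operand k σ}
    (hu : u ∈ g.args) : u.formalDegree degs ≤ g.formalDegree degs := by
  cases g with
  | sum args =>
    simp only [Gate.args, List.mem_map] at hu
    obtain ⟨a, ha, rfl⟩ := hu
    simp only [Gate.formalDegree]
    induction args with
    | nil => simp at ha
    | cons b rest ih =>
      simp only [List.map_cons, List.foldr_cons]
      rcases List.mem_cons.mp ha with rfl | ha
      · exact le_max_left _ _
      · exact (ih ha).trans (le_max_right _ _)
  | prod args =>
    simp only [Gate.args] at hu
    simp only [Gate.formalDegree]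
    induction args with
    | nil => simp at hu
    | cons b rest ih =>
      simp only [List.map_cons, List.sum_cons]
      rcases List.mem_cons.mp hu with rfl | hu
      · exact Nat.le_add_right _ _
      · exact (ih hu).trans (Nat.le_add_left _ _)

/-- A gate's value and formal degree only depend on the values and formal degrees of its
operands. [cite: Burgisser2000, Def. 2.1] -/
theorem gate_congr (g : Gate k σ) {vc vg : List (MvPolynomial σ k)} {dc dg : List ℕ}
    (h : ∀ u ∈ g.args, u.eval vc = u.eval vg ∧ u.formalDegree dc = u.formalDegree dg) :
    g.eval vc = g.eval vg ∧ g.formalDegree dc = g.formalDegree dg := by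
  cases g with
  | sum args =>
    have h' : ∀ a ∈ args, a.2.eval vc = a.2.eval vg ∧ a.2.formalDegree dc = a.2.formalDegree dg :=
      fun a ha => h a.2 (by simpa [Gate.args] using ⟨a.1, ha⟩)
    simp only [Gate.eval, Gate.formalDegree]
    refine ⟨?_, ?_⟩
    · rw [List.map_congr_left (fun a ha => by rw [(h' a ha).1])]
    · rw [List.map_congr_left (fun a ha => by rw [(h' a ha).2])]
  | prod args =>
    have h' : ∀ u ∈ args, u.eval vc = u.eval vg ∧ u.formalDegree dc = u.formalDegree dg :=
      fun u hu => h u (by simpa [Gate.args] using hu)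
    simp only [Gate.eval, Gate.formalDegree]
    refine ⟨?_, ?_⟩
    · rw [List.map_congr_left (fun u hu => (h' u hu).1)]
    · rw [List.map_congr_left (fun u hu => (h' u hu).2)]

/-- `getD` on `l ++ [a]` below the old length. [folklore] -/
private theorem getD_snoc_lt {α : Type*} (l : List α) (a d : α) {j : ℕ} (hj : j < l.length) :
    (l ++ [a]).getD j d = l.getD j d :=
  List.getD_append _ _ _ _ hj

/-- `getD` on `l ++ [a]` at the old length. [folklore] -/
private theorem getD_snoc_eq {α : Type*} (l : List α) (a d : α) :
    (l ++ [a]).getD l.length d = a := by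
  rw [List.getD_append_right _ _ _ _ le_rfl, Nat.sub_self, List.getD_cons_zero]

/-- `getD` on `l ++ [a]` above the old length. [folklore] -/
private theorem getD_snoc_gt {α : Type*} (l : List α) (a d : α) {j : ℕ} (hj : l.length < j) :
    (l ++ [a]).getD j d = d := by
  rw [List.getD_append_right _ _ _ _ hj.le]
  exact List.getD_eq_default _ _ (by simp; omega)

/-- **Capping.** For every gate list `gs` and bound `D` there is a gate list `cs` of the same
length, each of whose gates is a gate of `gs` or the empty sum `Σ ∅`, ALL of whose gate formal
degrees are `≤ D`, and which agrees with `gs` — in value and in formal degree — at every gate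
index of formal degree `≤ D` in `gs` (replace every gate of formal degree `> D` by `Σ ∅`; gates of
formal degree `≤ D` only reference gates of formal degree `≤ D`). [cite: Burgisser2006, §2.2] -/
theorem exists_cap_gates (D : ℕ) (gs : List (Gate k σ)) :
    ∃ cs : List (Gate k σ), cs.length = gs.length ∧ (∀ g ∈ cs, g ∈ gs ∨ g = Gate.sum []) ∧
      (∀ x ∈ gateFormalDegrees cs, x ≤ D) ∧
      ∀ j : ℕ, (gateFormalDegrees gs).getD j 1 ≤ D →
        (gateValues cs).getD j 0 = (gateValues gs).getD j 0 ∧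
        (gateFormalDegrees cs).getD j 1 = (gateFormalDegrees gs).getD j 1 := by
  induction gs using List.reverseRecOn with
  | nil => exact ⟨[], rfl, by simp, by simp [gateFormalDegrees], fun j _ => ⟨rfl, rfl⟩⟩
  | append_singleton gs g ih =>
    obtain ⟨cs, hlen, hmem, hfd, hagree⟩ := ih
    have hlv : (gateValues cs).length = (gateValues gs).length := by simp [hlen]
    have hld : (gateFormalDegrees cs).length = (gateFormalDegrees gs).length := by simp [hlen]
    have hlv' : (gateValues gs).length = gs.length := gateValues_length gs
    have hld' : (gateFormalDegrees gs).length = gs.length := gateFormalDegrees_length gs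
    -- operands of formal degree `≤ D` read the same value and formal degree in `cs` and `gs`
    have hop : ∀ u : Operand k σ, u.formalDegree (gateFormalDegrees gs) ≤ D →
        u.eval (gateValues cs) = u.eval (gateValues gs) ∧
        u.formalDegree (gateFormalDegrees cs) = u.formalDegree (gateFormalDegrees gs) := by
      intro u hu
      cases u with
      | var i => exact ⟨rfl, rfl⟩
      | const c => exact ⟨rfl, rfl⟩
      | gate j => exact hagree j hu
    have hmem' : ∀ c : Gate k σ, (c = g ∨ c = Gate.sum []) →
        ∀ g' ∈ cs ++ [c], g' ∈ gs ++ [g] ∨ g' = Gate.sum [] := by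
      intro c hc g' hg'
      rw [List.mem_append, List.mem_singleton] at hg'
      rcases hg' with hg' | rfl
      · rcases hmem g' hg' with h | h
        · exact Or.inl (List.mem_append_left _ h)
        · exact Or.inr h
      · rcases hc with rfl | rfl
        · exact Or.inl (by simp)
        · exact Or.inr rfl
    -- the index bookkeeping common to both cases, for `j ≠ gs.length`
    have hother : ∀ (c : Gate k σ) (j : ℕ), j ≠ gs.length →
        (gateFormalDegrees (gs ++ [g])).getD j 1 ≤ D →
        (gateValues (cs ++ [c])).getD j 0 = (gateValues (gs ++ [g])).getD j 0 ∧
        (gateFormalDegrees (cs ++ [c])).getD j 1 = (gateFormalDegrees (gs ++ [g])).getD j 1 := by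
      intro c j hj hD
      rw [gateValues_append_singleton, gateValues_append_singleton,
        gateFormalDegrees_append_singleton, gateFormalDegrees_append_singleton]
      rw [gateFormalDegrees_append_singleton] at hD
      rcases lt_or_gt_of_ne hj with hlt | hgt
      · rw [getD_snoc_lt _ _ _ (by omega)] at hD
        rw [getD_snoc_lt _ _ _ (by omega), getD_snoc_lt _ _ _ (by omega),
          getD_snoc_lt _ _ _ (by omega), getD_snoc_lt _ _ _ (by omega)]
        exact hagree j hD
      · rw [getD_snoc_gt _ _ _ (by omega), getD_snoc_gt _ _ _ (by omega),
          getD_snoc_gt _ _ _ (by omega), getD_snoc_gt _ _ _ (by omega)]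
        exact ⟨rfl, rfl⟩
    by_cases he : g.formalDegree (gateFormalDegrees gs) ≤ D
    · -- keep `g`: all its operands have formal degree `≤ D`, so it reads the same in `cs`
      have hg : g.eval (gateValues cs) = g.eval (gateValues gs) ∧
          g.formalDegree (gateFormalDegrees cs) = g.formalDegree (gateFormalDegrees gs) :=
        gate_congr g fun u hu => hop u ((operand_formalDegree_le_gate _ g hu).trans he)
      refine ⟨cs ++ [g], by simp [hlen], hmem' g (Or.inl rfl), ?_, ?_⟩
      · intro x hx
        rw [gateFormalDegrees_append_singleton, List.mem_append, List.mem_singleton] at hx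
        rcases hx with hx | rfl
        · exact hfd x hx
        · exact hg.2.le.trans he
      · intro j hD
        by_cases hj : j = gs.length
        · subst hj
          rw [gateValues_append_singleton, gateValues_append_singleton,
            gateFormalDegrees_append_singleton, gateFormalDegrees_append_singleton]
          rw [show gs.length = (gateValues cs).length by omega, getD_snoc_eq,
            show (gateValues cs).length = (gateValues gs).length by omega, getD_snoc_eq,
            show (gateValues gs).length = (gateFormalDegrees cs).length by omega, getD_snoc_eq,
            show (gateFormalDegrees cs).length = (gateFormalDegrees gs).length by omega,
            getD_snoc_eq]
          exact hg
        · exact hother g j hj hD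
    · -- drop `g`: it has formal degree `> D`, so no agreement is owed at its index
      refine ⟨cs ++ [Gate.sum []], by simp [hlen], hmem' _ (Or.inr rfl), ?_, ?_⟩
      · intro x hx
        rw [gateFormalDegrees_append_singleton, List.mem_append, List.mem_singleton] at hx
        rcases hx with hx | rfl
        · exact hfd x hx
        · simp [Gate.formalDegree]
      · intro j hD
        by_cases hj : j = gs.length
        · subst hj
          exfalso
          rw [gateFormalDegrees_append_singleton, show gs.length = (gateFormalDegrees gs).length
            by omega, getD_snoc_eq] at hD
          exact he hD
        · exact hother _ j hj hD

/-- **Every circuit may be assumed to have ALL gate formal degrees `≤` any bound `D` on its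
(output) formal degree**, at the same size, same value, and with every gate either kept or
replaced by the empty sum (so fan-in two is preserved). [cite: Burgisser2006, §2.2] -/
theorem exists_forall_gateFormalDegrees_le (Q : ArithCircuit k σ) {D : ℕ}
    (hD : Q.formalDegree ≤ D) :
    ∃ Q' : ArithCircuit k σ, Q'.eval = Q.eval ∧ Q'.size = Q.size ∧
      (Q.IsFanInTwo → Q'.IsFanInTwo) ∧ ∀ x ∈ gateFormalDegrees Q'.gates, x ≤ D := by
  obtain ⟨cs, hlen, hmem, hfd, hagree⟩ := exists_cap_gates D Q.gates
  have hop : ∀ u : Operand k σ, u.formalDegree (gateFormalDegrees Q.gates) ≤ D →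
      u.eval (gateValues cs) = u.eval (gateValues Q.gates) := by
    intro u hu
    cases u with
    | var i => rfl
    | const c => rfl
    | gate j => exact (hagree j hu).1
  refine ⟨⟨cs, Q.output⟩, hop Q.output hD, hlen, fun h2 g hg => ?_, hfd⟩
  rcases hmem g hg with h | rfl
  · exact h2 g h
  · simp [Gate.fanIn, Gate.args]

/-! ### The stub -/

/-- **Degree normal form** (stub `stub_degreeNF` of line `birth`, registered signature verbatim
= `Cruxes.TameNF.Birth.DegreeNF`, with `c = 4`): a fan-in-two `ℂ`-circuit `P` of size `≤ N`
computing `f` with `deg f ≤ N` can be replaced by a fan-in-two circuit computing `f` of size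
`≤ N⁴ + 4` all of whose gate formal degrees are `≤ N⁴ + 4`. Homogenisation with formal degree
(`ArithCircuit.exists_eq_formalDegree_le`: size `≤ N²·|P| + N ≤ N³ + N`, output formal degree
`≤ max N 1`) followed by capping (`exists_forall_gateFormalDegrees_le`).
[cite: BurgisserClausenShokrollahi1997, Lemma (21.25)] [cite: MalodPortier2008, Lemma 2] -/
theorem stub_degreeNF :
    ∃ c : ℕ, ∀ (n N : ℕ) (f : MvPolynomial (Fin n) ℂ) (P : ArithCircuit ℂ (Fin n)),
      P.IsFanInTwo → P.Computes f → P.size ≤ N → f.totalDegree ≤ N →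
      ∃ P' : ArithCircuit ℂ (Fin n), P'.Computes f ∧ P'.IsFanInTwo ∧ P'.size ≤ N ^ c + c ∧
        ∀ d ∈ ArithCircuit.gateFormalDegrees P'.gates, d ≤ N ^ c + c := by
  refine ⟨4, ?_⟩
  intro n N f P hfan hcomp hsize hdeg
  have hPf : P.eval = f := hcomp
  obtain ⟨Q, hfanQ, -, hQf, hQsize, hQdeg⟩ :=
    ArithCircuit.exists_eq_formalDegree_le P hfan (d := N) (hPf ▸ hdeg)
  have hfan2 : Q.IsFanInTwo := fun g hg => (hfanQ g hg).le
  obtain ⟨Q', hQ'f, hQ'size, hQ'fan, hQ'deg⟩ := exists_forall_gateFormalDegrees_le Q hQdeg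
  -- bookkeeping: `N³ + N ≤ N⁴ + 4` and `max N 1 ≤ N⁴ + 4`
  have hb : N ^ 2 * N + N ≤ N ^ 4 + 4 := by
    rcases Nat.lt_or_ge N 2 with h | h
    · interval_cases N <;> norm_num
    · have h3 : N + N ^ 3 ≤ N ^ 3 * N := by
        have : N ≤ N ^ 3 := by
          calc N = N ^ 1 := (pow_one N).symm
            _ ≤ N ^ 3 := Nat.pow_le_pow_right (by omega) (by omega)
        nlinarith
      calc N ^ 2 * N + N = N + N ^ 3 := by ring
        _ ≤ N ^ 3 * N := h3
        _ = N ^ 4 := by ring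
        _ ≤ N ^ 4 + 4 := Nat.le_add_right _ _
  have hm : max N 1 ≤ N ^ 4 + 4 :=
    max_le ((Nat.le_self_pow (show (4 : ℕ) ≠ 0 by omega) N).trans (Nat.le_add_right _ _))
      (by omega)
  refine ⟨Q', ?_, hQ'fan hfan2, ?_, fun d hd => (hQ'deg d hd).trans hm⟩
  · show Q'.eval = f
    rw [hQ'f, hQf, hPf]
  · rw [hQ'size]
    calc Q.size ≤ N ^ 2 * P.size + N := hQsize
      _ ≤ N ^ 2 * N + N := Nat.add_le_add_right (Nat.mul_le_mul_left _ hsize) _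
      _ ≤ N ^ 4 + 4 := hb

end Summit.ValiantsHypothesis.ValiantsHypothesis.Theorems.NumTame.TameNF

end
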